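import Summits.CriticalPhenomena.PercolationContinuityZ3.Theorems.PercNearOneGluingNoHeavyLowerTailMajorityGluingIsoPtsClassEvents
import Summits.CriticalPhenomena.PercolationContinuityZ3.Theorems.PercNearOneGluingNoHeavyLowerTailMajorityGluingHubRefreshIsoFiveClassMono
import HarnessLib

/-!
# LEMMA 1 of THEOREM E for m marked CLASSES — label-generic version (lane prim-rate, constants-miner 1, gen 31; CANDIDATES §GEN-16 R128/R130, §GEN-31)

Support file for the closed crux `NoHeavyLowerTail` (stmt-CriticalPhenomena-4575), majority-gluing line; file 3 of the kernel chain for the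
m-point isolation inequality (ISO₃ / ISO₄ of the abstract `(4,3)` programme).  Verbatim the five-class file `…MajorityGluingHubRefreshIsoFiveClassMono`
with the class labels in an arbitrary finite type `ι`: the point inequality `IsoFive.sep_clusterMono` (van den Berg–Häggström–Kahn Thm 1.3, any
finite set `X` of other points — already label-free) is transported to `m = #ι` marked CLASSES (`IsoPts.clsBot/clsIso/clsRch`): with all pairs
internal to the classes forced open, point events of representatives `t k` ARE the class events (`clsIso_iff_reps`, `clsBot_iff_reps`,
`clsRch_iff_rep`), and the class events are invariant under internal pairs (`clsIso_union_internal`, …); forcing pairs open is a change of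
weights (`IsoFive.real_eq_real_of_union`, reused).  Result: `cls_sep_clusterMono : μ(⊥)·μ(Iso_k ∩ {v ∈ C_k}) ≤ μ(Iso_k)·μ(⊥ ∩ {v ∈ C_k})`.
No definitions, no sorries. [cite: VandenbergHaggstromKahn2005, Thm. 1.3 (p. 6)]
-/

noncomputable section

namespace Summit.CriticalPhenomena.PercolationContinuityZ3.Theorems

namespace HubOnly
namespace Refresh
namespace IsoPts

open MeasureTheory
open Literature.Probability.LatticeModels (prodBernoulli)
open Literature.Probability.Percolation
open Literature.Probability.Percolation.BHK2006
open DecisionTree (ind ind_of_mem ind_of_not_mem ind_nonneg)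
open scoped Classical

section InternalSec
variable {V : Type*} {ι : Type*}
/-! ### Pairs internal to a class do not matter -/

section Internal

variable (c : V → Option ι)

/-- Forcing open a pair inside ONE class does not change `Iso_k` (any `k`). [folklore] -/
theorem clsIso_insert_internal {a b : V} {i : ι} (ha : c a = some i) (hb : c b = some i) (k : ι) (η : BondConfig V) :
    insert s(a, b) η ∈ clsIso c k ↔ η ∈ clsIso c k := by
  refine ⟨fun h => clsIso_anti c (Set.subset_insert _ _) h, fun h p q l hp hq hlk hr => ?_⟩
  rcases (KNSep.reachable_insert_iff η a b p q).1 hr with h1 | ⟨h2, h3⟩ | ⟨h2, h3⟩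
  · exact h p q l hp hq hlk h1
  · by_cases hik : i = k
    · subst hik; exact h b q l hb hq hlk h3
    · exact h p a i hp ha hik h2
  · by_cases hik : i = k
    · subst hik; exact h a q l ha hq hlk h3
    · exact h p b i hp hb hik h2

/-- Forcing open a pair inside one class does not change `⊥`. [folklore] -/
theorem clsBot_insert_internal {a b : V} {i : ι} (ha : c a = some i) (hb : c b = some i) (η : BondConfig V) :
    insert s(a, b) η ∈ clsBot c ↔ η ∈ clsBot c := by
  simp only [mem_clsBot_iff_forall_clsIso, clsIso_insert_internal c ha hb]

/-- Under `Iso_k`, forcing open a pair inside one class does not change whether class `k` reaches `v`. [folklore] -/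
theorem clsRch_insert_internal {a b : V} {i : ι} (ha : c a = some i) (hb : c b = some i) {k : ι} {v : V}
    {η : BondConfig V} (hiso : η ∈ clsIso c k) : insert s(a, b) η ∈ clsRch c k v ↔ η ∈ clsRch c k v := by
  refine ⟨fun ⟨p, hp, hr⟩ => ?_, fun h => clsRch_mono c (Set.subset_insert _ _) h⟩
  rcases (KNSep.reachable_insert_iff η a b p v).1 hr with h1 | ⟨h2, h3⟩ | ⟨h2, h3⟩
  · exact ⟨p, hp, h1⟩
  · by_cases hik : i = k
    · subst hik; exact ⟨b, hb, h3⟩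
    · exact absurd h2 (hiso p a i hp ha hik)
  · by_cases hik : i = k
    · subst hik; exact ⟨a, ha, h3⟩
    · exact absurd h2 (hiso p b i hp hb hik)

/-- Forcing open a finite SET of pairs internal to classes does not change `Iso_k`. [folklore] -/
theorem clsIso_union_internal (I : Finset (Sym2 V))
    (hI : ∀ e ∈ I, ∃ a b : V, ∃ i : ι, e = s(a, b) ∧ c a = some i ∧ c b = some i) (k : ι) (η : BondConfig V) :
    η ∪ ↑I ∈ clsIso c k ↔ η ∈ clsIso c k := by
  induction I using Finset.induction_on with
  | empty => simp
  | @insert f s hf ih =>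
    obtain ⟨a, b, i, rfl, ha, hb⟩ := hI _ (Finset.mem_insert_self _ _)
    have hI' : ∀ e ∈ s, ∃ a b : V, ∃ i : ι, e = s(a, b) ∧ c a = some i ∧ c b = some i :=
      fun e he => hI e (Finset.mem_insert_of_mem he)
    rw [Finset.coe_insert, Set.union_insert, clsIso_insert_internal c ha hb, ih hI']

/-- Forcing open a finite set of pairs internal to classes does not change `⊥`. [folklore] -/
theorem clsBot_union_internal (I : Finset (Sym2 V))
    (hI : ∀ e ∈ I, ∃ a b : V, ∃ i : ι, e = s(a, b) ∧ c a = some i ∧ c b = some i) (η : BondConfig V) :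
    η ∪ ↑I ∈ clsBot c ↔ η ∈ clsBot c := by
  simp only [mem_clsBot_iff_forall_clsIso, clsIso_union_internal c I hI]

/-- Under `Iso_k`, forcing open a finite set of pairs internal to classes does not change `v ∈ C_k`. [folklore] -/
theorem clsRch_union_internal (I : Finset (Sym2 V))
    (hI : ∀ e ∈ I, ∃ a b : V, ∃ i : ι, e = s(a, b) ∧ c a = some i ∧ c b = some i) {k : ι} {v : V}
    {η : BondConfig V} (hiso : η ∈ clsIso c k) : η ∪ ↑I ∈ clsRch c k v ↔ η ∈ clsRch c k v := by
  induction I using Finset.induction_on with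
  | empty => simp
  | @insert f s hf ih =>
    obtain ⟨a, b, i, rfl, ha, hb⟩ := hI _ (Finset.mem_insert_self _ _)
    have hI' : ∀ e ∈ s, ∃ a b : V, ∃ i : ι, e = s(a, b) ∧ c a = some i ∧ c b = some i :=
      fun e he => hI e (Finset.mem_insert_of_mem he)
    have hiso' : η ∪ ↑s ∈ clsIso c k := (clsIso_union_internal c s hI' k η).2 hiso
    rw [Finset.coe_insert, Set.union_insert, clsRch_insert_internal c ha hb hiso', ih hI']

/-- **Points = classes on configurations containing the class cliques.**  With representatives `t k` of the classes and all pairs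
internal to classes open, «`t k` is joined to no `t j`, `j ≠ k`» is «`Iso_k`». [folklore] -/
theorem clsIso_iff_reps {t : ι → V} (ht : ∀ k, c (t k) = some k) {η : BondConfig V}
    (hI : ∀ a b : V, ∀ i : ι, c a = some i → c b = some i → a ≠ b → s(a, b) ∈ η) (k : ι) :
    η ∈ clsIso c k ↔ ∀ j, j ≠ k → ¬ (openGraph η).Reachable (t k) (t j) := by
  have hrep : ∀ a i, c a = some i → (openGraph η).Reachable (t i) a := by
    intro a i ha
    by_cases h : t i = a
    · rw [h]
    · exact SimpleGraph.Adj.reachable ((openGraph_adj _ _ _).2 ⟨hI _ _ i (ht i) ha h, h⟩)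
  refine ⟨fun h j hjk => h (t k) (t j) j (ht k) (ht j) hjk, fun h a b j ha hb hjk hr => ?_⟩
  exact h j hjk (((hrep a k ha).trans hr).trans (hrep b j hb).symm)

/-- Points = classes: «`t k ↔ v`» is «`v ∈ C_k`» when the class cliques are open. [folklore] -/
theorem clsRch_iff_rep {t : ι → V} (ht : ∀ k, c (t k) = some k) {η : BondConfig V}
    (hI : ∀ a b : V, ∀ i : ι, c a = some i → c b = some i → a ≠ b → s(a, b) ∈ η) (k : ι) (v : V) :
    η ∈ clsRch c k v ↔ (openGraph η).Reachable (t k) v := by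
  have hrep : ∀ a i, c a = some i → (openGraph η).Reachable (t i) a := by
    intro a i ha
    by_cases h : t i = a
    · rw [h]
    · exact SimpleGraph.Adj.reachable ((openGraph_adj _ _ _).2 ⟨hI _ _ i (ht i) ha h, h⟩)
  exact ⟨fun ⟨a, ha, hr⟩ => (hrep a k ha).trans hr, fun h => ⟨t k, ht k, h⟩⟩

/-- Points = classes for the separation of the OTHER classes: «the `t j`, `j ≠ k`, pairwise not joined» is «`∀ j ≠ k, Iso_j` restricted…» —
precisely, with the cliques open, `(∀ j j', j ≠ k → j' ≠ k → j ≠ j' → t j ↮ t j')` together with `Iso_k` is `⊥`. [folklore] -/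
theorem clsBot_iff_reps {t : ι → V} (ht : ∀ k, c (t k) = some k) {η : BondConfig V}
    (hI : ∀ a b : V, ∀ i : ι, c a = some i → c b = some i → a ≠ b → s(a, b) ∈ η) (k : ι) :
    η ∈ clsBot c ↔ (η ∈ clsIso c k ∧ ∀ j j', j ≠ k → j' ≠ k → j ≠ j' → ¬ (openGraph η).Reachable (t j) (t j')) := by
  rw [mem_clsBot_iff_forall_clsIso]
  constructor
  · intro h
    exact ⟨h k, fun j j' _ _ hjj' => (clsIso_iff_reps c ht hI j).1 (h j) j' (Ne.symm hjj')⟩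
  · rintro ⟨hk, h⟩ j
    by_cases hjk : j = k
    · subst hjk; exact hk
    · rw [clsIso_iff_reps c ht hI]
      intro j' hj'j
      by_cases hj'k : j' = k
      · subst hj'k
        exact fun hr => (clsIso_iff_reps c ht hI j').1 hk j hjk hr.symm
      · exact h j j' hjk hj'k (Ne.symm hj'j)

end Internal


end InternalSec

section ClassMono

variable {V : Type} [Fintype V] {ι : Type*} [Fintype ι]

/-- **LEMMA 1 for classes** (K1-PROOF.md §2, class form used by the kernel induction): for `m = #ι` marked classes with representatives
`t k` and any vertex `v`,  `μ(⊥)·μ(Iso_k ∩ {v ∈ C_k}) ≤ μ(Iso_k)·μ(⊥ ∩ {v ∈ C_k})`.  Reduced to the point version `sep_clusterMono` at the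
weights with all pairs internal to classes forced open (there point events = class events), the class events being invariant under
internal pairs. [cite: VandenbergHaggstromKahn2005, Thm. 1.3 (p. 6)] -/
theorem cls_sep_clusterMono (w : Sym2 V → unitInterval) (c : V → Option ι) (t : ι → V)
    (ht : ∀ k, c (t k) = some k) (k : ι) (v : V) :
    (prodBernoulli w).real (clsBot c) * (prodBernoulli w).real (clsIso c k ∩ clsRch c k v) ≤
      (prodBernoulli w).real (clsIso c k) * (prodBernoulli w).real (clsBot c ∩ clsRch c k v) := by
  -- internal pairs and the forced-open weights
  set I : Finset (Sym2 V) := Finset.univ.filter fun e =>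
    ∃ a b : V, ∃ i : ι, e = s(a, b) ∧ c a = some i ∧ c b = some i with hIdef
  have hI : ∀ e ∈ I, ∃ a b : V, ∃ i : ι, e = s(a, b) ∧ c a = some i ∧ c b = some i := fun e he =>
    (Finset.mem_filter.1 he).2
  have hImem : ∀ (η : BondConfig V) (a b : V) (i : ι), c a = some i → c b = some i → a ≠ b → s(a, b) ∈ η ∪ ↑I :=
    fun η a b i ha hb _ => Set.mem_union_right _ (Finset.mem_coe.2 (Finset.mem_filter.2 ⟨Finset.mem_univ _, a, b, i, rfl, ha, hb⟩))
  set w' : Sym2 V → unitInterval := fun e => if e ∈ (I : Set (Sym2 V)) then 1 else w e with hw'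
  have hI1 : ∀ e ∈ (I : Set (Sym2 V)), w' e = 1 := fun e he => by simp only [hw', if_pos he]
  have hI2 : ∀ e ∉ (I : Set (Sym2 V)), w' e = w e := fun e he => by simp only [hw', if_neg he]
  -- the representatives of the other classes
  set X : Finset V := (Finset.univ.filter fun j => j ≠ k).image t with hX
  have ht_inj : ∀ j j', t j = t j' → j = j' := fun j j' h =>
    Option.some_injective _ ((ht j).symm.trans (by rw [h]; exact ht j'))
  have hmemX : ∀ x, x ∈ X ↔ ∃ j, j ≠ k ∧ t j = x := fun x => by
    simp only [hX, Finset.mem_image, Finset.mem_filter, Finset.mem_univ, true_and]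
  have hs : t k ∉ X := fun h => by
    obtain ⟨j, hjk, hj⟩ := (hmemX _).1 h
    exact hjk (ht_inj j k hj)
  -- the point inequality at `w'`
  have key := IsoFive.sep_clusterMono w' (t k) v X hs
  -- point events on `η ∪ I` = class events on `η`
  have e_iso : ∀ η : BondConfig V, (∀ x ∈ X, ¬ (openGraph (η ∪ ↑I)).Reachable (t k) x) ↔ η ∈ clsIso c k := by
    intro η
    rw [← clsIso_union_internal c I hI k η, clsIso_iff_reps c ht (hImem η) k]
    constructor
    · intro h j hjk; exact h (t j) ((hmemX _).2 ⟨j, hjk, rfl⟩)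
    · intro h x hx; obtain ⟨j, hjk, rfl⟩ := (hmemX _).1 hx; exact h j hjk
  have e_bot : ∀ η : BondConfig V, ((∀ x ∈ X, ¬ (openGraph (η ∪ ↑I)).Reachable (t k) x) ∧
      ∀ x ∈ X, ∀ x' ∈ X, x ≠ x' → ¬ (openGraph (η ∪ ↑I)).Reachable x x') ↔ η ∈ clsBot c := by
    intro η
    rw [← clsBot_union_internal c I hI η, clsBot_iff_reps c ht (hImem η) k]
    refine and_congr ((e_iso η).trans (clsIso_union_internal c I hI k η).symm) ?_
    constructor
    · intro h j j' hj hj' hjj'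
      exact h (t j) ((hmemX _).2 ⟨j, hj, rfl⟩) (t j') ((hmemX _).2 ⟨j', hj', rfl⟩) (fun h' => hjj' (ht_inj _ _ h'))
    · intro h x hx x' hx' hxx'
      obtain ⟨j, hj, rfl⟩ := (hmemX _).1 hx
      obtain ⟨j', hj', rfl⟩ := (hmemX _).1 hx'
      exact h j j' hj hj' (fun h' => hxx' (by rw [h']))
  have e_rch : ∀ η : BondConfig V, η ∈ clsIso c k →
      ((openGraph (η ∪ ↑I)).Reachable (t k) v ↔ η ∈ clsRch c k v) := by
    intro η hiso
    rw [← clsRch_union_internal c I hI hiso, clsRch_iff_rep c ht (hImem η) k v]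
  -- the four probabilities
  have r1 : (prodBernoulli w').real {ω : BondConfig V | (∀ x ∈ X, ¬ (openGraph ω).Reachable (t k) x) ∧
      ∀ x ∈ X, ∀ x' ∈ X, x ≠ x' → ¬ (openGraph ω).Reachable x x'} = (prodBernoulli w).real (clsBot c) :=
    IsoFive.real_eq_real_of_union w w' ↑I hI1 hI2 _ _ fun η => e_bot η
  have r2 : (prodBernoulli w').real {ω : BondConfig V | (∀ x ∈ X, ¬ (openGraph ω).Reachable (t k) x) ∧
      (openGraph ω).Reachable (t k) v} = (prodBernoulli w).real (clsIso c k ∩ clsRch c k v) :=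
    IsoFive.real_eq_real_of_union w w' ↑I hI1 hI2 _ _ fun η => by
      rw [Set.mem_inter_iff]
      constructor
      · rintro ⟨h1, h2⟩
        have hiso := (e_iso η).1 h1
        exact ⟨hiso, (e_rch η hiso).1 h2⟩
      · rintro ⟨h1, h2⟩
        exact ⟨(e_iso η).2 h1, (e_rch η h1).2 h2⟩
  have r3 : (prodBernoulli w').real {ω : BondConfig V | ∀ x ∈ X, ¬ (openGraph ω).Reachable (t k) x} =
      (prodBernoulli w).real (clsIso c k) :=
    IsoFive.real_eq_real_of_union w w' ↑I hI1 hI2 _ _ fun η => e_iso η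
  have r4 : (prodBernoulli w').real {ω : BondConfig V | (∀ x ∈ X, ¬ (openGraph ω).Reachable (t k) x) ∧
      (∀ x ∈ X, ∀ x' ∈ X, x ≠ x' → ¬ (openGraph ω).Reachable x x') ∧ (openGraph ω).Reachable (t k) v} =
      (prodBernoulli w).real (clsBot c ∩ clsRch c k v) :=
    IsoFive.real_eq_real_of_union w w' ↑I hI1 hI2 _ _ fun η => by
      rw [Set.mem_inter_iff]
      constructor
      · rintro ⟨h1, h2, h3⟩
        have hiso := (e_iso η).1 h1
        exact ⟨(e_bot η).1 ⟨h1, h2⟩, (e_rch η hiso).1 h3⟩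
      · rintro ⟨h1, h2⟩
        have hiso : η ∈ clsIso c k := (mem_clsBot_iff_forall_clsIso c).1 h1 k
        exact ⟨((e_bot η).2 h1).1, ((e_bot η).2 h1).2, (e_rch η hiso).2 h2⟩
  rw [r1, r2, r3, r4] at key
  exact key

end ClassMono

end IsoPts
end Refresh
end HubOnly
end Summit.CriticalPhenomena.PercolationContinuityZ3.Theorems
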